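import Mathlib
import Summits.ValiantsHypothesis.ValiantsHypothesis.Theorems.FifoMatchingNNNotVPDivisionSplitDefs
import Summits.ValiantsHypothesis.ValiantsHypothesis.Theorems.FifoMatchingNNNotVPSpreadCofactorLowDegree
import Literature.Computability.AlgebraicComplexity.NestFreeMatchingPoly
import HarnessLib

/-!
# Route FifoMatching — crux `NNNotVP` (stmt-ValiantsHypothesis-11615), line `division_split`:
# stub B2 `stub_spreadCofactorReduction` ⟺ its SPREAD ∧ HYPER-DEGREE tier

Stub B2 of the registered line (`Cruxes/NNNotVP/Lines/division_split.lean`): there is `k` such that every nonzero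
cofactor `h` of `NN_n` can be traded for a cofactor `h'` having a monomial of support `≤ (log₂ n + k)^k`, with
`L₊(NN_n · h') ≤ 2^((log₂ n + log₂(L₊(NN_n h) + L₊(h)) + k)^k)`.

* `spreadCofactorReduction_of_smallSupportMonomial` — for a cofactor that already HAS a monomial of support
  `≤ (log₂ n + k)^k` the trade is free: `h' := h` (`L₊(NN_n h) < 2^(log₂(L₊(NN_n h) + L₊ h) + 1)`), at rate `k + 1`.
* `spreadCofactorReduction_iff_spreadTier` — hence B2 (verbatim on the left) ⟺ its restriction to SPREAD cofactors
  (every monomial uses more than `(log₂ n + k)^k` distinct arcs, the SAME `k` as the rate).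
* `spreadCofactorReduction_iff_spreadHyperDegreeTier` — folding in g0's landed low-degree tier
  (`spreadCofactorReduction_of_totalDegree_le`: `h' := 1` and the exponential rung `GridCorShadow.expRung_holds`):
  B2 ⟺ its restriction to cofactors that are spread AND of total degree `> 2^⌊n^{1/8}⌋`.

Reading (for the planner): on the residual tier no monomial of `h` and no face reduction supplies `h'`; the only
`h'` in sight is `h' := 1`, which needs `log₂(L₊(NN_n h) + L₊ h) ≳ n^{1/k}` (`complexity_NN_le`) — so B2 is a
division lower bound of EXPONENTIAL type for spread hyper-degree cofactors, whereas the crux `NNDivisionHard`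
(stmt-21181) it serves needs only the super-quasi-polynomial bound (cf. `NNDivisionHard.Residual` /
`NNDivisionHard.WindowAvoidance`, landed today, for the residual class by name).

HONEST FRAMING: bookkeeping equivalences for the planner; B2's spread hyper-degree tier, `NNDivisionHard`,
`NNNotVP` and VP ≠ VNP are OPEN / NOT proved.  No definitions, no named facts, no sorry. [folklore]
-/

noncomputable section

-- Sub = Summit single-conjunct layout: the duplicated namespace component is mandated by the tree.
set_option linter.dupNamespace false
set_option autoImplicit false

namespace Summit.ValiantsHypothesis.ValiantsHypothesis.Theorems.FifoMatching.NNNotVP.DivisionSplit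

open MvPolynomial Literature.Computability.AlgebraicComplexity
open scoped NNReal BigOperators Classical

/-- The conclusion of B2 for a pair `(h, h')` is monotone in the rate parameter `k` (the rate
`(a + k)^k` is monotone in `k` — the tree's `logLevel_mono`, a module of another route, is not imported here).
[folklore] -/
theorem spreadConclusion_mono {k k' : ℕ} (hkk' : k ≤ k') (n : ℕ) (h h' : MvPolynomial (σ n) ℝ≥0)
    (H : (∃ m ∈ h'.support, m.support.card ≤ (Nat.log 2 n + k) ^ k) ∧
      complexity (NN n * h') ≤
        2 ^ ((Nat.log 2 n + Nat.log 2 (complexity (NN n * h) + complexity h) + k) ^ k)) :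
    (∃ m ∈ h'.support, m.support.card ≤ (Nat.log 2 n + k') ^ k') ∧
      complexity (NN n * h') ≤
        2 ^ ((Nat.log 2 n + Nat.log 2 (complexity (NN n * h) + complexity h) + k') ^ k') := by
  have rate : ∀ a : ℕ, (a + k) ^ k ≤ (a + k') ^ k' := by
    intro a
    rcases Nat.eq_zero_or_pos k' with hk' | hk'
    · subst hk'
      obtain rfl : k = 0 := Nat.le_zero.mp hkk'
      exact le_rfl
    · calc (a + k) ^ k ≤ (a + k') ^ k := Nat.pow_le_pow_left (by omega) k
        _ ≤ (a + k') ^ k' := Nat.pow_le_pow_right (by omega) hkk'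
  obtain ⟨⟨m, hm, hmc⟩, hc⟩ := H
  exact ⟨⟨m, hm, hmc.trans (rate _)⟩, hc.trans (Nat.pow_le_pow_right (by norm_num) (rate _))⟩


/-- **The trade is free for a cofactor with a small-support monomial** (`h' := h`, rate `k + 1`):
`L₊(NN_n h) ≤ L₊(NN_n h) + L₊ h < 2^(log₂(L₊(NN_n h) + L₊ h) + 1) ≤ 2^((log₂ n + log₂(…) + (k+1))^(k+1))`.
[folklore] -/
theorem spreadCofactorReduction_of_smallSupportMonomial (k n : ℕ) (h : MvPolynomial (σ n) ℝ≥0)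
    (hm : ∃ m ∈ h.support, m.support.card ≤ (Nat.log 2 n + k) ^ k) :
    ∃ h' : MvPolynomial (σ n) ℝ≥0, (∃ m ∈ h'.support, m.support.card ≤ (Nat.log 2 n + (k + 1)) ^ (k + 1)) ∧
      complexity (NN n * h') ≤
        2 ^ ((Nat.log 2 n + Nat.log 2 (complexity (NN n * h) + complexity h) + (k + 1)) ^ (k + 1)) := by
  obtain ⟨m, hm, hmc⟩ := hm
  have hrate : (Nat.log 2 n + k) ^ k ≤ (Nat.log 2 n + (k + 1)) ^ (k + 1) :=
    (Nat.pow_le_pow_left (by omega) k).trans (Nat.pow_le_pow_right (by omega) (Nat.le_succ k))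
  refine ⟨h, ⟨m, hm, hmc.trans hrate⟩, ?_⟩
  set L := complexity (NN n * h) + complexity h with hL
  have h1 : complexity (NN n * h) ≤ L := Nat.le_add_right _ _
  have h2 : L < 2 ^ (Nat.log 2 L + 1) := Nat.lt_pow_succ_log_self (by norm_num) L
  have h3 : Nat.log 2 L + 1 ≤ (Nat.log 2 n + Nat.log 2 L + (k + 1)) ^ (k + 1) := by
    calc Nat.log 2 L + 1 ≤ Nat.log 2 n + Nat.log 2 L + (k + 1) := by omega
      _ = (Nat.log 2 n + Nat.log 2 L + (k + 1)) ^ 1 := (pow_one _).symm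
      _ ≤ (Nat.log 2 n + Nat.log 2 L + (k + 1)) ^ (k + 1) := Nat.pow_le_pow_right (by omega) (by omega)
  exact h1.trans (h2.le.trans (Nat.pow_le_pow_right (by norm_num) h3))

/-- **B2 ⟺ its SPREAD tier.**  Stub `stub_spreadCofactorReduction` (verbatim on the left) is equivalent to its
restriction to cofactors all of whose monomials use MORE than `(log₂ n + k)^k` distinct arcs (same `k` as the
rate): the others are traded for themselves (`spreadCofactorReduction_of_smallSupportMonomial`). [folklore] -/
theorem spreadCofactorReduction_iff_spreadTier :
    (∃ k : ℕ, ∀ (n : ℕ) (h : MvPolynomial (σ n) ℝ≥0), h ≠ 0 →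
      ∃ h' : MvPolynomial (σ n) ℝ≥0, (∃ m ∈ h'.support, m.support.card ≤ (Nat.log 2 n + k) ^ k) ∧
        complexity (NN n * h') ≤
          2 ^ ((Nat.log 2 n + Nat.log 2 (complexity (NN n * h) + complexity h) + k) ^ k)) ↔
    (∃ k : ℕ, ∀ (n : ℕ) (h : MvPolynomial (σ n) ℝ≥0), h ≠ 0 →
      (∀ m ∈ h.support, (Nat.log 2 n + k) ^ k < m.support.card) →
      ∃ h' : MvPolynomial (σ n) ℝ≥0, (∃ m ∈ h'.support, m.support.card ≤ (Nat.log 2 n + k) ^ k) ∧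
        complexity (NN n * h') ≤
          2 ^ ((Nat.log 2 n + Nat.log 2 (complexity (NN n * h) + complexity h) + k) ^ k)) := by
  constructor
  · rintro ⟨k, hk⟩
    exact ⟨k, fun n h hh _ => hk n h hh⟩
  · rintro ⟨k, hk⟩
    refine ⟨k + 1, fun n h hh => ?_⟩
    by_cases hsmall : ∃ m ∈ h.support, m.support.card ≤ (Nat.log 2 n + k) ^ k
    · exact spreadCofactorReduction_of_smallSupportMonomial k n h hsmall
    · have hspread : ∀ m ∈ h.support, (Nat.log 2 n + k) ^ k < m.support.card := fun m hm => by
        by_contra hle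
        exact hsmall ⟨m, hm, not_lt.mp hle⟩
      obtain ⟨h', hh'⟩ := hk n h hh hspread
      exact ⟨h', spreadConclusion_mono (Nat.le_succ k) n h h' hh'⟩

/-- **B2 ⟺ its SPREAD ∧ HYPER-DEGREE tier.**  Stub `stub_spreadCofactorReduction` (verbatim on the left) is
equivalent to its restriction to cofactors that are spread (every monomial uses more than `(log₂ n + k)^k`
distinct arcs) AND of total degree `> 2^⌊n^{1/8}⌋` (g0's `spreadCofactorReduction_of_totalDegree_le` trades the
low-degree ones for `h' := 1`). [folklore] -/
theorem spreadCofactorReduction_iff_spreadHyperDegreeTier :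
    (∃ k : ℕ, ∀ (n : ℕ) (h : MvPolynomial (σ n) ℝ≥0), h ≠ 0 →
      ∃ h' : MvPolynomial (σ n) ℝ≥0, (∃ m ∈ h'.support, m.support.card ≤ (Nat.log 2 n + k) ^ k) ∧
        complexity (NN n * h') ≤
          2 ^ ((Nat.log 2 n + Nat.log 2 (complexity (NN n * h) + complexity h) + k) ^ k)) ↔
    (∃ k : ℕ, ∀ (n : ℕ) (h : MvPolynomial (σ n) ℝ≥0), h ≠ 0 →
      (∀ m ∈ h.support, (Nat.log 2 n + k) ^ k < m.support.card) →
      2 ^ Nat.sqrt (Nat.sqrt (Nat.sqrt n)) < h.totalDegree →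
      ∃ h' : MvPolynomial (σ n) ℝ≥0, (∃ m ∈ h'.support, m.support.card ≤ (Nat.log 2 n + k) ^ k) ∧
        complexity (NN n * h') ≤
          2 ^ ((Nat.log 2 n + Nat.log 2 (complexity (NN n * h) + complexity h) + k) ^ k)) := by
  constructor
  · rintro ⟨k, hk⟩
    exact ⟨k, fun n h hh _ _ => hk n h hh⟩
  · rintro ⟨k₁, hk₁⟩
    obtain ⟨k₀, hk₀⟩ := spreadCofactorReduction_of_totalDegree_le
    -- work at the common rate `K := max k₀ k₁`, then add one for the free trade
    set K := max k₀ k₁ with hK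
    refine ⟨K + 1, fun n h hh => ?_⟩
    by_cases hsmall : ∃ m ∈ h.support, m.support.card ≤ (Nat.log 2 n + K) ^ K
    · exact spreadCofactorReduction_of_smallSupportMonomial K n h hsmall
    · by_cases hd : h.totalDegree ≤ 2 ^ Nat.sqrt (Nat.sqrt (Nat.sqrt n))
      · obtain ⟨h', hh'⟩ := hk₀ n h hh hd
        exact ⟨h', spreadConclusion_mono (by omega) n h h' hh'⟩
      · have hspread : ∀ m ∈ h.support, (Nat.log 2 n + k₁) ^ k₁ < m.support.card := fun m hm => by
          by_contra hle
          have hrate : (Nat.log 2 n + k₁) ^ k₁ ≤ (Nat.log 2 n + K) ^ K := by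
            rcases Nat.eq_zero_or_pos K with hK0 | hK0
            · have : k₁ = 0 := by omega
              rw [hK0, this]
            · exact (Nat.pow_le_pow_left (by omega) k₁).trans
                (Nat.pow_le_pow_right (by omega) (le_max_right k₀ k₁))
          exact hsmall ⟨m, hm, (not_lt.mp hle).trans hrate⟩
        obtain ⟨h', hh'⟩ := hk₁ n h hh hspread (lt_of_not_ge hd)
        exact ⟨h', spreadConclusion_mono (by omega) n h h' hh'⟩

end Summit.ValiantsHypothesis.ValiantsHypothesis.Theorems.FifoMatching.NNNotVP.DivisionSplit

end
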